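import Mathlib
import HarnessLib
import Summits.QuantumFields.YangMills.Theses.PencilRigidity
import Summits.QuantumFields.YangMills.Theorems.PencilRigidityCurvatureKernelBoundLatticeTruncatedTwoPointBound

/-!
# `CurvatureKernelBound` — lemmas for stub L3 `LatticeWindowTransfer` (support for stmt-QuantumFields-11687)

Crux `stmt-QuantumFields-11687` (`PencilRigidity.CurvatureKernelBound`), line `sixteen-charts-analytic-kernel`, stub L3
(skeleton v8), helper file. Contents: the power estimate on the window `t^(η−10) ≤ (3/2)^η 2¹⁰ s^(η−10)` for
`t ∈ [s/2, 3s/2]`; the algebra of the three estimates with a generic constant; the geometry of a contributing pair; the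
shift-invariance of the covariance; the REFINED truncated lattice two-point bound `|LS₂ − LS₁LS₁| ≤ D R_k(f₀) R_k(f₁)` from a
per-pair renormalised covariance bound `c_k² |Cov_k(A_x, A_y)| ≤ D` on contributing pairs (L1's double-sum expansion with the
crude `(2B)²` replaced by `D`); and boundedness of a kernel continuous off `0` on a compact axial segment. [folklore]
-/

noncomputable section

open scoped BigOperators Topology SchwartzMap ComplexConjugate
open MeasureTheory Filter Set
open Literature.MathematicalPhysics.QuantumLattice Literature.MathematicalPhysics.AQFT
open Literature.MathematicalPhysics.QuantumFieldTheory
open Literature.Probability.LatticeModels (Site box mem_box)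
open Summit.QuantumFields.YangMills.Theorems.StrongCouplingIRTrivial.TwoPoint

namespace Summit.QuantumFields.YangMills.Theorems.CurvatureKernel

namespace LatticeWindow

/-! ## Elementary estimates -/

/-- **Powers on the window.** For `0 < η`, `0 < s` and `s/2 ≤ t ≤ 3s/2`:
`t^(η−10) ≤ (3/2)^η · 2¹⁰ · s^(η−10)`. [folklore] -/
theorem rpow_window_le {η s t : ℝ} (hη : 0 < η) (hs : 0 < s) (h1 : s / 2 ≤ t) (h2 : t ≤ 3 * s / 2) :
    t ^ (η - 10) ≤ (3 / 2) ^ η * 2 ^ (10 : ℝ) * s ^ (η - 10) := by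
  have ht : 0 < t := lt_of_lt_of_le (half_pos hs) h1
  have e1 : t ^ (η - 10) = t ^ η * t ^ (-(10 : ℝ)) := by
    rw [sub_eq_add_neg, Real.rpow_add ht]
  have e2 : s ^ (η - 10) = s ^ η * s ^ (-(10 : ℝ)) := by
    rw [sub_eq_add_neg, Real.rpow_add hs]
  have b1 : t ^ η ≤ (3 / 2) ^ η * s ^ η := by
    rw [← Real.mul_rpow (by norm_num) hs.le]
    exact Real.rpow_le_rpow ht.le (by linarith) hη.le
  have b2 : t ^ (-(10 : ℝ)) ≤ 2 ^ (10 : ℝ) * s ^ (-(10 : ℝ)) := by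
    have h3 : t ^ (-(10 : ℝ)) ≤ (s / 2) ^ (-(10 : ℝ)) :=
      Real.rpow_le_rpow_of_nonpos (half_pos hs) h1 (by norm_num)
    have h4 : (s / 2) ^ (-(10 : ℝ)) = 2 ^ (10 : ℝ) * s ^ (-(10 : ℝ)) := by
      rw [Real.div_rpow hs.le zero_le_two, Real.rpow_neg zero_le_two, div_inv_eq_mul, mul_comm]
    rw [← h4]
    exact h3
  rw [e1, e2]
  calc t ^ η * t ^ (-(10 : ℝ)) ≤ ((3 / 2) ^ η * s ^ η) * (2 ^ (10 : ℝ) * s ^ (-(10 : ℝ))) :=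
        mul_le_mul b1 b2 (Real.rpow_nonneg ht.le _) (by positivity)
    _ = (3 / 2) ^ η * 2 ^ (10 : ℝ) * (s ^ η * s ^ (-(10 : ℝ))) := by ring

/-- **Algebra of the three estimates** (generic constant). From `‖S − κI₀ · κI₁‖ ≤ D (3ε)⁴(3ε)⁴` (lattice side),
`‖K(ξ) I₀I₁ − S‖ ≤ I₀I₁` (bump localisation), `0 ≤ D` and `I₀, I₁ ≥ (ε/2)⁴ v₁` (inner balls):
`‖K(ξ)‖ ≤ ‖κ‖² + 1 + D 6⁸ / v₁²`. [folklore] -/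
theorem norm_le_of_estimates {Kξ S κ : ℂ} {I₀ I₁ D ε v₁ : ℝ} (hv₁ : 0 < v₁) (hε : 0 < ε) (hD : 0 ≤ D)
    (hI₀ : (ε / 2) ^ 4 * v₁ ≤ I₀) (hI₁ : (ε / 2) ^ 4 * v₁ ≤ I₁)
    (hZ : ‖S - κ * (I₀ : ℂ) * (κ * (I₁ : ℂ))‖ ≤ D * (3 * ε) ^ 4 * (3 * ε) ^ 4)
    (h2 : ‖Kξ * ((I₀ * I₁ : ℝ) : ℂ) - S‖ ≤ I₀ * I₁) :
    ‖Kξ‖ ≤ ‖κ‖ ^ 2 + 1 + D * 6 ^ 8 / v₁ ^ 2 := by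
  have hQ0 : 0 ≤ D * 6 ^ 8 / v₁ ^ 2 := by positivity
  have hlow : 0 < (ε / 2) ^ 4 * v₁ := by positivity
  have hI₀pos : 0 < I₀ := hlow.trans_le hI₀
  have hP : 0 < I₀ * I₁ := mul_pos hI₀pos (hlow.trans_le hI₁)
  have hDst : D * (3 * ε) ^ 4 * (3 * ε) ^ 4 ≤ D * 6 ^ 8 / v₁ ^ 2 * (I₀ * I₁) := by
    have hQ : D * (3 * ε) ^ 4 * (3 * ε) ^ 4 =
        D * 6 ^ 8 / v₁ ^ 2 * ((ε / 2) ^ 4 * v₁ * ((ε / 2) ^ 4 * v₁)) := by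
      field_simp
      ring
    rw [hQ]
    exact mul_le_mul_of_nonneg_left (mul_le_mul hI₀ hI₁ hlow.le hI₀pos.le) hQ0
  have e1 : ‖Kξ‖ * (I₀ * I₁) = ‖Kξ * ((I₀ * I₁ : ℝ) : ℂ)‖ := by
    rw [norm_mul, Complex.norm_real, Real.norm_of_nonneg hP.le]
  have e2 : ‖κ * (I₀ : ℂ) * (κ * (I₁ : ℂ))‖ = ‖κ‖ ^ 2 * (I₀ * I₁) := by
    rw [show κ * (I₀ : ℂ) * (κ * (I₁ : ℂ)) = κ ^ 2 * ((I₀ * I₁ : ℝ) : ℂ) by push_cast; ring,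
      norm_mul, norm_pow, Complex.norm_real, Real.norm_of_nonneg hP.le]
  have tri : ‖Kξ * ((I₀ * I₁ : ℝ) : ℂ)‖ ≤ ‖Kξ * ((I₀ * I₁ : ℝ) : ℂ) - S‖ +
      ‖S - κ * (I₀ : ℂ) * (κ * (I₁ : ℂ))‖ + ‖κ * (I₀ : ℂ) * (κ * (I₁ : ℂ))‖ := by
    calc ‖Kξ * ((I₀ * I₁ : ℝ) : ℂ)‖ = ‖(Kξ * ((I₀ * I₁ : ℝ) : ℂ) - S) +
          (S - κ * (I₀ : ℂ) * (κ * (I₁ : ℂ))) + κ * (I₀ : ℂ) * (κ * (I₁ : ℂ))‖ := by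
          congr 1; ring
      _ ≤ _ := norm_add₃_le
  have hkey : ‖Kξ‖ * (I₀ * I₁) ≤ (‖κ‖ ^ 2 + 1 + D * 6 ^ 8 / v₁ ^ 2) * (I₀ * I₁) := by
    rw [e1]
    linarith [tri, h2, hZ, e2, hDst]
  exact le_of_mul_le_mul_right hkey hP

/-- **Geometry of a contributing pair.** If `dist u ξ < ε`, `‖v‖ < ε`, `ε ≤ ‖ξ‖/4` then
`‖ξ‖/2 < ‖u − v‖ < 3‖ξ‖/2`. [folklore] -/
theorem norm_sub_mem_window {E : Type*} [NormedAddCommGroup E] {u v ξ : E} {ε : ℝ}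
    (hu : dist u ξ < ε) (hv : ‖v‖ < ε) (hε : ε ≤ ‖ξ‖ / 4) :
    ‖ξ‖ / 2 < ‖u - v‖ ∧ ‖u - v‖ < 3 * ‖ξ‖ / 2 := by
  rw [dist_eq_norm] at hu
  have hd : ‖(u - v) - ξ‖ < 2 * ε := by
    calc ‖(u - v) - ξ‖ = ‖(u - ξ) - v‖ := by congr 1; abel
      _ ≤ ‖u - ξ‖ + ‖v‖ := norm_sub_le _ _
      _ < 2 * ε := by linarith
  have h1 := norm_sub_norm_le (u - v) ξ
  have h2 := norm_sub_norm_le ξ (u - v)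
  rw [norm_sub_rev ξ (u - v)] at h2
  constructor <;> linarith [abs_le.1 (abs_norm_sub_norm_le (u - v) ξ)]

/-! ## Covariance algebra -/

/-- The covariance is insensitive to additive constants:
`∫ (X − p)(Y − q) − (∫ (X − p))(∫ (Y − q)) = ∫ XY − (∫X)(∫Y)` under a probability measure. [folklore] -/
theorem cov_sub_const_eq {Ω : Type*} [MeasurableSpace Ω] (μ : Measure Ω) [IsProbabilityMeasure μ]
    {X Y : Ω → ℝ} (hX : Integrable X μ) (hY : Integrable Y μ)
    (hXY : Integrable (fun ω => X ω * Y ω) μ) (p q : ℝ) :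
    ∫ ω, (X ω - p) * (Y ω - q) ∂μ - (∫ ω, (X ω - p) ∂μ) * (∫ ω, (Y ω - q) ∂μ) =
      ∫ ω, X ω * Y ω ∂μ - (∫ ω, X ω ∂μ) * (∫ ω, Y ω ∂μ) := by
  have h1 : ∫ ω, (X ω - p) ∂μ = (∫ ω, X ω ∂μ) - p := by
    rw [integral_sub hX (integrable_const _), integral_const, probReal_univ, one_smul]
  have h2 : ∫ ω, (Y ω - q) ∂μ = (∫ ω, Y ω ∂μ) - q := by
    rw [integral_sub hY (integrable_const _), integral_const, probReal_univ, one_smul]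
  rw [integral_sub_const_mul_sub_const μ hX hY hXY, h1, h2]
  ring

/-! ## The truncated lattice two-point function against a per-pair covariance bound -/

section Lattice

variable {G : Type} [Group G] [TopologicalSpace G] [IsTopologicalGroup G] [CompactSpace G]
  [MeasurableSpace G] [BorelSpace G]

/-- **Refined truncated bound.** If every pair of sites CONTRIBUTING to the smearing (`f₀(a x) ≠ 0`, `f₁(a y) ≠ 0`) has
renormalised covariance `c_k² |Cov_k(A_x, A_y)| ≤ D`, then `|LS₂(f₀,f₁) − LS₁(f₀) LS₁(f₁)| ≤ D · R_k(f₀) · R_k(f₁)`,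
`R_k(f) = a_k⁴ Σ_{x ∈ box} |f(a_k x)|` (the double-sum expansion of L1 with the crude bound `(2B)²` replaced by `D`).
[folklore] -/
theorem abs_truncated_le_of_cov_le (r : LatticeRep G) (sch : SpeciesScheme (YMSpecies G)) (A : YMSpecies G)
    (k : ℕ) (f : Fin 2 → 𝓢(EuclideanSpace ℝ (Fin 4), ℝ)) {D : ℝ}
    (hD : ∀ x ∈ box 4 (sch.L k), ∀ y ∈ box 4 (sch.L k),
      f 0 (sch.a k • siteToE x) ≠ 0 → f 1 (sch.a k • siteToE y) ≠ 0 →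
        (sch.c A k) ^ 2 *
          |(∫ U, A.F (configShift (-x) (torusLift (sch.side k) U)) *
              A.F (configShift (-y) (torusLift (sch.side k) U))
              ∂(wilsonMeasure r.ρ (sch.β k) : MeasureTheory.Measure (GaugeConfig 4 (sch.side k) G))) -
            (∫ U, A.F (configShift (-x) (torusLift (sch.side k) U))
              ∂(wilsonMeasure r.ρ (sch.β k) : MeasureTheory.Measure (GaugeConfig 4 (sch.side k) G))) *
            (∫ U, A.F (configShift (-y) (torusLift (sch.side k) U))
              ∂(wilsonMeasure r.ρ (sch.β k) : MeasureTheory.Measure (GaugeConfig 4 (sch.side k) G)))| ≤ D) :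
    |latticeSchwinger r.ρ sch (fun s => s.F) k 2 (fun _ => A) f -
        latticeSchwinger r.ρ sch (fun s => s.F) k 1 (fun _ => A) (fun _ => f 0) *
          latticeSchwinger r.ρ sch (fun s => s.F) k 1 (fun _ => A) (fun _ => f 1)| ≤
      D * ((sch.a k) ^ 4 * ∑ x ∈ box 4 (sch.L k), |f 0 (sch.a k • siteToE x)|) *
        ((sch.a k) ^ 4 * ∑ x ∈ box 4 (sch.L k), |f 1 (sch.a k • siteToE x)|) := by
  haveI : IsProbabilityMeasure (wilsonMeasure r.ρ (sch.β k) : MeasureTheory.Measure (GaugeConfig 4 (sch.side k) G)) :=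
    isProbabilityMeasure_wilsonMeasure (d := 4) (L := sch.side k) r.ρ r.continuous (sch.β k)
  set μ := wilsonMeasure (d := 4) (L := sch.side k) r.ρ (sch.β k) with hμ
  set X : Site 4 → GaugeConfig 4 (sch.side k) G → ℝ :=
    fun x U => A.F (configShift (-x) (torusLift (sch.side k) U)) with hX
  set m : ℝ := sch.m A k with hm
  set c : ℝ := sch.c A k with hc
  set a : ℝ := sch.a k with ha
  set Λ : Finset (Site 4) := box 4 (sch.L k) with hΛ
  obtain ⟨B, hB⟩ := A.bounded
  have hXmeas : ∀ x, AEStronglyMeasurable (X x) μ := fun x =>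
    (A.measurable.comp ((configShift (-x)).measurable.comp
      (measurable_torusLift (sch.side k)))).aestronglyMeasurable
  have hIX : ∀ x, Integrable (X x) μ := fun x =>
    Integrable.of_bound (hXmeas x) B (ae_of_all _ fun U => by rw [Real.norm_eq_abs]; exact hB _)
  have hIXX : ∀ x y, Integrable (fun U => X x U * X y U) μ := fun x y =>
    (hIX x).mul_bdd (hXmeas y) (c := B) (ae_of_all _ fun U => by rw [Real.norm_eq_abs]; exact hB _)
  -- the covariance with and without the additive counterterm
  have hcovm : ∀ x y, ∫ U, (X x U - m) * (X y U - m) ∂μ -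
      (∫ U, (X x U - m) ∂μ) * (∫ U, (X y U - m) ∂μ) =
      ∫ U, X x U * X y U ∂μ - (∫ U, X x U ∂μ) * (∫ U, X y U ∂μ) := fun x y =>
    cov_sub_const_eq μ (hIX x) (hIX y) (hIXX x y) m m
  -- the two-point and one-point functions as sums
  have h2 : latticeSchwinger r.ρ sch (fun s => s.F) k 2 (fun _ => A) f =
      c * c * a ^ 8 * ∑ x ∈ Λ, ∑ y ∈ Λ, f 0 (a • siteToE x) * f 1 (a • siteToE y) *
        ∫ U, (X x U - m) * (X y U - m) ∂μ := by
    rw [latticeSchwinger_two_eq r.ρ r.continuous sch (fun s => s.F) k (fun _ => A) f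
      (fun _ => A.measurable) (fun _ => A.bounded)]
    rfl
  have h1 : ∀ u : 𝓢(EuclideanSpace ℝ (Fin 4), ℝ),
      latticeSchwinger r.ρ sch (fun s => s.F) k 1 (fun _ => A) (fun _ => u) =
        c * a ^ 4 * ∑ x ∈ Λ, u (a • siteToE x) * ∫ U, (X x U - m) ∂μ := by
    intro u
    rw [latticeSchwinger_one_eq r.ρ r.continuous sch (fun s => s.F) k (fun _ => A) (fun _ => u)
      A.measurable A.bounded]
  -- the truncated function as a double sum
  have hdiff : latticeSchwinger r.ρ sch (fun s => s.F) k 2 (fun _ => A) f -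
      latticeSchwinger r.ρ sch (fun s => s.F) k 1 (fun _ => A) (fun _ => f 0) *
        latticeSchwinger r.ρ sch (fun s => s.F) k 1 (fun _ => A) (fun _ => f 1) =
      ∑ x ∈ Λ, ∑ y ∈ Λ, c * c * a ^ 8 * (f 0 (a • siteToE x) * f 1 (a • siteToE y)) *
        (∫ U, (X x U - m) * (X y U - m) ∂μ -
          (∫ U, (X x U - m) ∂μ) * (∫ U, (X y U - m) ∂μ)) := by
    rw [h2, h1 (f 0), h1 (f 1), mul_sum_mul_mul_sum, Finset.mul_sum, ← Finset.sum_sub_distrib]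
    refine Finset.sum_congr rfl fun x _ => ?_
    rw [Finset.mul_sum, ← Finset.sum_sub_distrib]
    refine Finset.sum_congr rfl fun y _ => ?_
    ring
  -- termwise bound
  have hterm : ∀ x ∈ Λ, ∀ y ∈ Λ, |c * c * a ^ 8 * (f 0 (a • siteToE x) * f 1 (a • siteToE y)) *
      (∫ U, (X x U - m) * (X y U - m) ∂μ -
        (∫ U, (X x U - m) ∂μ) * (∫ U, (X y U - m) ∂μ))| ≤
      D * (a ^ 4 * a ^ 4 * (|f 0 (a • siteToE x)| * |f 1 (a • siteToE y)|)) := by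
    intro x hx y hy
    rw [hcovm]
    by_cases h0 : f 0 (a • siteToE x) = 0
    · rw [h0]; simp
    by_cases h1' : f 1 (a • siteToE y) = 0
    · rw [h1']; simp
    have hDxy := hD x hx y hy h0 h1'
    have ha8 : |a ^ 8| = a ^ 4 * a ^ 4 := by
      rw [abs_of_nonneg (by positivity)]; ring
    have hre : |c * c * a ^ 8 * (f 0 (a • siteToE x) * f 1 (a • siteToE y)) *
        (∫ U, X x U * X y U ∂μ - (∫ U, X x U ∂μ) * (∫ U, X y U ∂μ))| =
        (a ^ 4 * a ^ 4 * (|f 0 (a • siteToE x)| * |f 1 (a • siteToE y)|)) *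
          (c ^ 2 * |∫ U, X x U * X y U ∂μ - (∫ U, X x U ∂μ) * (∫ U, X y U ∂μ)|) := by
      simp only [abs_mul, abs_mul_abs_self, ha8]
      ring
    rw [hre, mul_comm D]
    exact mul_le_mul_of_nonneg_left hDxy (by positivity)
  -- sum up
  calc |latticeSchwinger r.ρ sch (fun s => s.F) k 2 (fun _ => A) f -
        latticeSchwinger r.ρ sch (fun s => s.F) k 1 (fun _ => A) (fun _ => f 0) *
          latticeSchwinger r.ρ sch (fun s => s.F) k 1 (fun _ => A) (fun _ => f 1)|
      = |∑ x ∈ Λ, ∑ y ∈ Λ, c * c * a ^ 8 * (f 0 (a • siteToE x) * f 1 (a • siteToE y)) *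
          (∫ U, (X x U - m) * (X y U - m) ∂μ -
            (∫ U, (X x U - m) ∂μ) * (∫ U, (X y U - m) ∂μ))| := by rw [hdiff]
    _ ≤ ∑ x ∈ Λ, |∑ y ∈ Λ, c * c * a ^ 8 * (f 0 (a • siteToE x) * f 1 (a • siteToE y)) *
          (∫ U, (X x U - m) * (X y U - m) ∂μ -
            (∫ U, (X x U - m) ∂μ) * (∫ U, (X y U - m) ∂μ))| :=
        Finset.abs_sum_le_sum_abs _ _
    _ ≤ ∑ x ∈ Λ, ∑ y ∈ Λ, |c * c * a ^ 8 * (f 0 (a • siteToE x) * f 1 (a • siteToE y)) *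
          (∫ U, (X x U - m) * (X y U - m) ∂μ -
            (∫ U, (X x U - m) ∂μ) * (∫ U, (X y U - m) ∂μ))| :=
        Finset.sum_le_sum fun x _ => Finset.abs_sum_le_sum_abs _ _
    _ ≤ ∑ x ∈ Λ, ∑ y ∈ Λ, D * (a ^ 4 * a ^ 4 * (|f 0 (a • siteToE x)| * |f 1 (a • siteToE y)|)) :=
        Finset.sum_le_sum fun x hx => Finset.sum_le_sum fun y hy => hterm x hx y hy
    _ = D * (a ^ 4 * ∑ x ∈ Λ, |f 0 (a • siteToE x)|) * (a ^ 4 * ∑ x ∈ Λ, |f 1 (a • siteToE x)|) := by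
        rw [mul_assoc D, mul_sum_mul_mul_sum, Finset.mul_sum]
        refine Finset.sum_congr rfl fun x _ => ?_
        rw [Finset.mul_sum]

end Lattice

/-! ## The axial segment is compact and avoids the origin -/

/-- `EuclideanSpace.single 0 t = t • EuclideanSpace.single 0 1`. [folklore] -/
theorem single_eq_smul (t : ℝ) :
    (EuclideanSpace.single (0 : Fin 4) t : EuclideanSpace ℝ (Fin 4)) =
      t • EuclideanSpace.single (0 : Fin 4) (1 : ℝ) := by
  ext i
  by_cases hi : i = 0
  · subst hi; simp
  · simp [hi]

/-- Continuity of the axial embedding `t ↦ t e₀`. [folklore] -/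
theorem continuous_single_axis :
    Continuous fun t : ℝ => (EuclideanSpace.single (0 : Fin 4) t : EuclideanSpace ℝ (Fin 4)) := by
  have : (fun t : ℝ => (EuclideanSpace.single (0 : Fin 4) t : EuclideanSpace ℝ (Fin 4))) =
      fun t : ℝ => t • EuclideanSpace.single (0 : Fin 4) (1 : ℝ) := funext single_eq_smul
  rw [this]
  exact continuous_id.smul continuous_const

/-- **A kernel continuous off the origin is bounded on the axial segment `{t e₀ : s₀ ≤ t ≤ 1}`, `s₀ > 0`.** [folklore] -/
theorem exists_bound_on_axial_segment {K : EuclideanSpace ℝ (Fin 4) → ℂ}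
    (hcont : ContinuousOn K {x : EuclideanSpace ℝ (Fin 4) | x ≠ 0}) {s₀ : ℝ} (hs₀ : 0 < s₀) :
    ∃ M : ℝ, 0 ≤ M ∧ ∀ t : ℝ, s₀ ≤ t → t ≤ 1 → ‖K (EuclideanSpace.single 0 t)‖ ≤ M := by
  have hmaps : Set.MapsTo (fun t : ℝ => (EuclideanSpace.single (0 : Fin 4) t : EuclideanSpace ℝ (Fin 4)))
      (Set.Icc s₀ 1) {x : EuclideanSpace ℝ (Fin 4) | x ≠ 0} := by
    intro t ht h0
    have : t = 0 := (PiLp.single_eq_zero_iff 2 _).1 h0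
    exact absurd this (ne_of_gt (lt_of_lt_of_le hs₀ ht.1))
  have hc : ContinuousOn (fun t : ℝ => K (EuclideanSpace.single (0 : Fin 4) t)) (Set.Icc s₀ 1) :=
    hcont.comp continuous_single_axis.continuousOn hmaps
  obtain ⟨M, hM⟩ := isCompact_Icc.exists_bound_of_continuousOn hc
  refine ⟨max M 0, le_max_right _ _, fun t h1 h2 => (hM t ⟨h1, h2⟩).trans (le_max_left _ _)⟩

end LatticeWindow

/-- **`RefinedLatticeTruncatedBound`** (registered sub-goal of stmt-QuantumFields-11687; = `LatticeWindow.abs_truncated_le_of_cov_le`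
with all arguments explicit). If every pair of sites contributing to the smearing has renormalised covariance `c_k² |Cov_k(A_x,A_y)| ≤ D`,
then `|LS₂(f₀,f₁) − LS₁(f₀) LS₁(f₁)| ≤ D · R_k(f₀) · R_k(f₁)`. [folklore] -/
theorem RefinedLatticeTruncatedBound : open Literature.MathematicalPhysics.QuantumLattice Literature.MathematicalPhysics.AQFT Literature.MathematicalPhysics.QuantumFieldTheory in ∀ (G : Type) [Group G] [TopologicalSpace G] [IsTopologicalGroup G] [CompactSpace G] [MeasurableSpace G] [BorelSpace G] (r : LatticeRep G) (sch : SpeciesScheme (YMSpecies G)) (A : YMSpecies G) (k : ℕ) (f : Fin 2 → SchwartzMap (EuclideanSpace ℝ (Fin 4)) ℝ) (D : ℝ), (∀ x ∈ Literature.Probability.LatticeModels.box 4 (sch.L k), ∀ y ∈ Literature.Probability.LatticeModels.box 4 (sch.L k), f 0 (sch.a k • siteToE x) ≠ 0 → f 1 (sch.a k • siteToE y) ≠ 0 → (sch.c A k) ^ 2 * |(∫ U, A.F (configShift (-x) (torusLift (sch.side k) U)) * A.F (configShift (-y) (torusLift (sch.side k) U)) ∂(wilsonMeasure r.ρ (sch.β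 k) : MeasureTheory.Measure (GaugeConfig 4 (sch.side k) G))) - (∫ U, A.F (configShift (-x) (torusLift (sch.side k) U)) ∂(wilsonMeasure r.ρ (sch.β k) : MeasureTheory.Measure (GaugeConfig 4 (sch.side k) G))) * (∫ U, A.F (configShift (-y) (torusLift (sch.side k) U)) ∂(wilsonMeasure r.ρ (sch.β k) : MeasureTheory.Measure (GaugeConfig 4 (sch.side k) G)))| ≤ D) → |latticeSchwinger r.ρ sch (fun s => s.F) k 2 (fun _ => A) f - latticeSchwinger r.ρ sch (fun s => s.F) k 1 (fun _ => A) (fun _ => f 0) * latticeSchwinger r.ρ sch (fun s => s.F) k 1 (fun _ => A) (fun _ => f 1)| ≤ D * ((sch.a k) ^ 4 * ∑ x ∈ Literature.Probability.LatticeModels.box 4 (sch.L k), |f 0 (sch.a k • siteToE x)|) * ((sch.a k) ^ 4 * ∑ x ∈ Literature.Probability.LatticeModels.box 4 (sch.L k), |f 1 (sch.a k • siteToE x)|) :=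
  fun _ _ _ _ _ _ _ r sch A k f _ hD => LatticeWindow.abs_truncated_le_of_cov_le r sch A k f hD

end Summit.QuantumFields.YangMills.Theorems.CurvatureKernel

end
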